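import Mathlib
import Summits.PneNP.PneNP.Theorems.ClusUniversalCertificateCubeC
import Summits.PneNP.PneNP.Theorems.ClusUniversalCertificateLayerDefs

/-!
# Route ClusUniversalCertificate — the hypercube certificate inequality, IV: the block case `m = 2` AWAY FROM CORE BLOCKS

Support file for `stmt-PneNP-19683` (`Summit.PneNP.PneNP.Theses.ClusUniversalCertificate.UniversalCertAll`, rung F-N1; cell
pnp-ideate).  PORT into the tree of the lit seat's kernel-verified ROUND-5 §T.12(a)/§T.13 theorems (record
HOME/pnp-ideate-lit/UniversalCertificate.lean ll. 800–1001, sha256 04edba6e…, referee g15 SCORE PASS 2026-08-26; author pnp-ideate-lit g6),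
which Parts I–III (`…CubeA/B/C`, m = 1) did not include:

* `universalCert_two_of_split` (SPLITTING LEMMA + `l1Cert_holds (2n)`): for `Y ⊆ (𝔽₂²)ⁿ` and block automorphisms `g_k` of `𝔽₂²`, if
  in every block `|Y| + 4·#{y_k = 0} ≥ 2·#{(g_k y_k)_0 = 0} + 2·#{(g_k y_k)_1 = 0}`, then p1's certificate inequality
  `Σ_{y∈Y} (n − codim_Y y) ≤ Σ_k 4·#{y ∈ Y : y_k = 0}` holds at `Y` (the `m = 1` theorem in the `2n` split bit coordinates; the block
  re-coordinatisation `(𝔽₂²)ⁿ ≃ₗ 𝔽₂^{2n}` is built inside the proof, no new definition);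
* `universalCert_two_of_nonCore` (**the block certificate at `m = 2` for every `Y` with NO CORE BLOCK**): if every block `k` has distinct
  nonzero values `x_k, y_k` with `c_k(x_k) + c_k(y_k) ≤ c_k(0) + c_k(x_k + y_k)` — some pair works iff `c_k(0) + c_k^max ≥ c_k^mid + c_k^min`
  — then the inequality holds at `Y`;
* `ucIneq_two_of_nonCore`: the same conclusion in the layer line's vocabulary `ClusLayer.UCIneq n 2 Y` (the two certificate codimensions are
  the same `sInf`, `rfl`).

So the OPEN part of the crux at `m = 2` is exactly the sets with a core block (in particular every set in which `0` is the strictly rarest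
value of some block), cf. ROUND-5 §T.12(e).  HONEST FRAMING: a partial result (`--supports`) for an OPEN crux; the load-bearing stubs of the
registered skeletons remain open; FRONTIER rung F-N1 — nothing here bears on P vs NP.  [folklore; ROUND-5 §T.12–§T.13]
-/

set_option linter.dupNamespace false -- `Summit.PneNP.PneNP.…`: summit = sub-problem name (D-0017 single-conjunct layout)

namespace Summit.PneNP.PneNP.Theorems.ClusCube

open Classical Finset

noncomputable section

/-- Every element of `ZMod 2` is `0` or `1`. -/
private lemma zmod2_eq_zero_or_one' (z : ZMod 2) : z = 0 ∨ z = 1 := by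
  fin_cases z
  · exact Or.inl rfl
  · exact Or.inr rfl

/-- **`UniversalCert n 2` at every `Y` admitting a good split in each block** (splitting lemma + `l1Cert_holds (2n)`; lit g6,
ROUND-5 §T.12(a)): if `g_k` are linear automorphisms of `𝔽₂²` with
`|Y| + 4·#{y : y_k = 0} ≥ 2·#{y : (g_k y_k)_0 = 0} + 2·#{y : (g_k y_k)_1 = 0}` for every block `k`, then
`Σ_{y ∈ Y} (n − codim_Y(y)) ≤ Σ_k 4·#{y ∈ Y : y_k = 0}`. -/
theorem universalCert_two_of_split (n : ℕ) (Y : Finset (Block.U n 2))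
    (g : Fin n → ((Fin 2 → ZMod 2) ≃ₗ[ZMod 2] (Fin 2 → ZMod 2)))
    (hcond : ∀ k : Fin n,
      2 * ((Y.filter fun y => g k (y k) 0 = 0).card : ℤ) +
        2 * ((Y.filter fun y => g k (y k) 1 = 0).card : ℤ) ≤
          (Y.card : ℤ) + 4 * ((Y.filter fun y => y k = 0).card : ℤ)) :
    ∑ y ∈ Y, ((n : ℤ) - (Block.codimIn Y y : ℤ)) ≤
      ∑ k : Fin n, (2 : ℤ) ^ 2 * ((Y.filter fun y => y k = 0).card : ℤ) := by
  -- the block re-coordinatisation `(𝔽₂²)ⁿ ≃ₗ 𝔽₂^{2n}` reading `g_k(y_k)` as two bits (lit's `split2`, built inline)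
  obtain ⟨E, hEapp⟩ : ∃ E : Block.U n 2 ≃ₗ[ZMod 2] V (n * 2),
      ∀ (y : Block.U n 2) (k : Fin n) (j : Fin 2), E y (finProdFinEquiv (k, j)) = g k (y k) j :=
    ⟨(LinearEquiv.piCongrRight g).trans
      ((LinearEquiv.curry (ZMod 2) (ZMod 2) (Fin n) (Fin 2)).symm.trans
        (LinearEquiv.funCongrLeft (ZMod 2) (ZMod 2) finProdFinEquiv.symm)),
      fun y k j => by simp [LinearMap.funLeft_apply, Function.uncurry]⟩
  have he : Function.Injective E := E.injective
  set Y' : Finset (V (n * 2)) := Y.image E with hY'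
  -- transport of the certificate codimension
  have hcod : ∀ y ∈ Y, codimIn Y' (E y) ≤ Block.codimIn Y y := by
    intro y hy
    have hne : {c | ∃ A : AffineSubspace (ZMod 2) (Block.U n 2), y ∈ A ∧ (∀ z ∈ A, z ∈ Y) ∧
        n * 2 ≤ Module.finrank (ZMod 2) A.direction + c}.Nonempty := by
      refine ⟨n * 2, AffineSubspace.mk' y ⊥, AffineSubspace.self_mem_mk' _ _, ?_, by simp⟩
      intro z hz
      rw [AffineSubspace.mem_mk'] at hz
      have : z = y := by
        rw [Submodule.mem_bot, vsub_eq_sub, sub_eq_zero] at hz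
        exact hz
      rw [this]
      exact hy
    have hmem : Block.codimIn Y y ∈ {c | ∃ A : AffineSubspace (ZMod 2) (Block.U n 2),
        y ∈ A ∧ (∀ z ∈ A, z ∈ Y) ∧ n * 2 ≤ Module.finrank (ZMod 2) A.direction + c} :=
      Nat.sInf_mem hne
    obtain ⟨A, hyA, hAY, hdimA⟩ := hmem
    apply Nat.sInf_le
    refine ⟨A.map ((E : Block.U n 2 →ₗ[ZMod 2] V (n * 2)).toAffineMap), ?_, ?_, ?_⟩
    · exact AffineSubspace.mem_map.mpr ⟨y, hyA, rfl⟩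
    · intro z hz
      obtain ⟨w, hw, rfl⟩ := AffineSubspace.mem_map.mp hz
      rw [hY']
      exact mem_image_of_mem _ (hAY w hw)
    · rw [AffineSubspace.map_direction, LinearMap.toAffineMap_linear, LinearEquiv.finrank_map_eq]
      simpa using hdimA
  have hL1 := l1Cert_holds (n * 2) Y'
  have h1 : ∑ y ∈ Y, ((n : ℤ) - (Block.codimIn Y y : ℤ))
      ≤ ∑ y ∈ Y, ((n : ℤ) - (codimIn Y' (E y) : ℤ)) := by
    refine sum_le_sum fun y hy => ?_
    have := hcod y hy
    omega
  have h2 : ∑ y ∈ Y, ((n : ℤ) - (codimIn Y' (E y) : ℤ))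
      = (n : ℤ) * Y.card - ∑ y' ∈ Y', (codimIn Y' y' : ℤ) := by
    rw [sum_sub_distrib, sum_const, hY', sum_image (fun a _ b _ h => he h)]
    simp [mul_comm]
  -- the signed count of bit `(k, j)`
  have h3 : ∀ (k : Fin n) (j : Fin 2),
      (Y.card : ℤ) - 2 * ((Y.filter fun y => g k (y k) j = 0).card : ℤ)
        ≤ |∑ y' ∈ Y', (if y' (finProdFinEquiv (k, j)) = 0 then (1 : ℤ) else -1)| := by
    intro k j
    set i : Fin (n * 2) := finProdFinEquiv (k, j) with hi
    have hs : (∑ y' ∈ Y', (if y' i = 0 then (1 : ℤ) else -1))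
        = ((Y'.filter fun y' => y' i = 0).card : ℤ) - ((Y'.filter fun y' => ¬ y' i = 0).card : ℤ) := by
      rw [Finset.sum_ite, sum_const, sum_const]
      simp
      ring
    have htot : (Y'.filter fun y' => y' i = 0).card + (Y'.filter fun y' => ¬ y' i = 0).card
        = Y'.card := Finset.card_filter_add_card_filter_not _
    have hcardY' : Y'.card = Y.card := by rw [hY', card_image_of_injective _ he]
    have h0 : (Y'.filter fun y' => y' i = 0).card = (Y.filter fun y => g k (y k) j = 0).card := by
      rw [hY', Finset.filter_image, card_image_of_injective _ he]
      congr 1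
      ext y
      simp only [mem_filter, hi, hEapp]
    rw [hs]
    have := neg_abs_le (((Y'.filter fun y' => y' i = 0).card : ℤ)
      - ((Y'.filter fun y' => ¬ y' i = 0).card : ℤ))
    omega
  -- sum over the `2n` bits, block by block
  have h4 : ∑ i : Fin (n * 2), |∑ y' ∈ Y', (if y' i = 0 then (1 : ℤ) else -1)|
      = ∑ k : Fin n, ∑ j : Fin 2,
          |∑ y' ∈ Y', (if y' (finProdFinEquiv (k, j)) = 0 then (1 : ℤ) else -1)| := by
    rw [← Fintype.sum_prod_type']
    exact (Fintype.sum_equiv finProdFinEquiv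
      (fun p : Fin n × Fin 2 =>
        |∑ y' ∈ Y', (if y' (finProdFinEquiv (p.1, p.2)) = 0 then (1 : ℤ) else -1)|)
      (fun i => |∑ y' ∈ Y', (if y' i = 0 then (1 : ℤ) else -1)|) (fun p => rfl)).symm
  have h5 : ∀ k : Fin n,
      2 * (Y.card : ℤ) - ((Y.card : ℤ) + 4 * ((Y.filter fun y => y k = 0).card : ℤ))
        ≤ ∑ j : Fin 2, |∑ y' ∈ Y', (if y' (finProdFinEquiv (k, j)) = 0 then (1 : ℤ) else -1)| := by
    intro k
    rw [Fin.sum_univ_two]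
    have := h3 k 0
    have := h3 k 1
    have := hcond k
    linarith
  have h6 : (n : ℤ) * Y.card - 4 * ∑ k : Fin n, ((Y.filter fun y => y k = 0).card : ℤ)
      ≤ ∑ i : Fin (n * 2), |∑ y' ∈ Y', (if y' i = 0 then (1 : ℤ) else -1)| := by
    rw [h4]
    have := sum_le_sum fun k (_ : k ∈ (univ : Finset (Fin n))) => h5 k
    rw [sum_sub_distrib, sum_const, card_univ, Fintype.card_fin, sum_add_distrib, sum_const,
      card_univ, Fintype.card_fin, ← mul_sum] at this
    simp only [nsmul_eq_mul] at this
    linarith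
  calc ∑ y ∈ Y, ((n : ℤ) - (Block.codimIn Y y : ℤ))
      ≤ (n : ℤ) * Y.card - ∑ y' ∈ Y', (codimIn Y' y' : ℤ) := h1.trans h2.le
    _ ≤ 4 * ∑ k : Fin n, ((Y.filter fun y => y k = 0).card : ℤ) := by linarith [hL1, h6]
    _ = ∑ k : Fin n, (2 : ℤ) ^ 2 * ((Y.filter fun y => y k = 0).card : ℤ) := by
        rw [mul_sum]; norm_num


/-- two distinct nonzero vectors of `𝔽₂²` (indeed of any `𝔽₂`-space) are linearly independent -/
lemma linearIndependent_pair_zmod2 {x y : Fin 2 → ZMod 2} (hx : x ≠ 0) (hy : y ≠ 0)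
    (hxy : x ≠ y) : LinearIndependent (ZMod 2) ![x, y] := by
  rw [LinearIndependent.pair_iff' hx]
  intro a
  rcases zmod2_eq_zero_or_one' a with rfl | rfl
  · rw [zero_smul]; exact hy.symm
  · rw [one_smul]; exact hxy

/-- **`UniversalCert n 2` away from core blocks** (ROUND-5 §T.12 (a), Corollary): if in every
block `k` there are distinct nonzero values `x_k, y_k` with
`2·#{v_k ∈ {0, y_k}} + 2·#{v_k ∈ {0, x_k}} ≤ |Y| + 4·#{v_k = 0}` — equivalently
`c_k(x_k) + c_k(y_k) ≤ c_k(0) + c_k(x_k + y_k)`, which some pair satisfies iff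
`c_k(0) + c_k^max ≥ c_k^mid + c_k^min` — then p1's universal certificate inequality holds at `Y`:
`Σ_{v ∈ Y} (n − codim_Y(v)) ≤ Σ_k 4·#{v ∈ Y : v_k = 0}`. -/
theorem universalCert_two_of_nonCore (n : ℕ) (Y : Finset (Block.U n 2))
    (x y : Fin n → (Fin 2 → ZMod 2)) (hx : ∀ k, x k ≠ 0) (hy : ∀ k, y k ≠ 0)
    (hxy : ∀ k, x k ≠ y k)
    (hcond : ∀ k : Fin n,
      2 * ((Y.filter fun v => v k = 0 ∨ v k = y k).card : ℤ) +
        2 * ((Y.filter fun v => v k = 0 ∨ v k = x k).card : ℤ) ≤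
          (Y.card : ℤ) + 4 * ((Y.filter fun v => v k = 0).card : ℤ)) :
    ∑ v ∈ Y, ((n : ℤ) - (Block.codimIn Y v : ℤ)) ≤
      ∑ k : Fin n, (2 : ℤ) ^ 2 * ((Y.filter fun v => v k = 0).card : ℤ) := by
  classical
  have hcard : Fintype.card (Fin 2) = Module.finrank (ZMod 2) (Fin 2 → ZMod 2) :=
    (Module.finrank_fintype_fun_eq_card (ZMod 2)).symm
  let b : ∀ k : Fin n, Module.Basis (Fin 2) (ZMod 2) (Fin 2 → ZMod 2) := fun k =>
    basisOfLinearIndependentOfCardEqFinrank (linearIndependent_pair_zmod2 (hx k) (hy k) (hxy k))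
      hcard
  have hb0 : ∀ k, b k 0 = x k := fun k => by
    simp only [b, coe_basisOfLinearIndependentOfCardEqFinrank]; rfl
  have hb1 : ∀ k, b k 1 = y k := fun k => by
    simp only [b, coe_basisOfLinearIndependentOfCardEqFinrank]; rfl
  refine universalCert_two_of_split n Y (fun k => (b k).equivFun) fun k => ?_
  -- coordinates in the splitting basis: `v = c₀ • x_k + c₁ • y_k`
  have key0 : ∀ v : Fin 2 → ZMod 2, (b k).equivFun v 0 = 0 ↔ (v = 0 ∨ v = y k) := by
    intro v
    have hv := (b k).sum_equivFun v
    rw [Fin.sum_univ_two, hb0, hb1] at hv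
    constructor
    · intro h0
      rw [h0, zero_smul, zero_add] at hv
      rcases zmod2_eq_zero_or_one' ((b k).equivFun v 1) with h1 | h1
      · left; rw [← hv, h1, zero_smul]
      · right; rw [← hv, h1, one_smul]
    · rintro (rfl | rfl)
      · simp
      · have := (b k).equivFun_self 1 0
        rw [hb1] at this
        simpa using this
  have key1 : ∀ v : Fin 2 → ZMod 2, (b k).equivFun v 1 = 0 ↔ (v = 0 ∨ v = x k) := by
    intro v
    have hv := (b k).sum_equivFun v
    rw [Fin.sum_univ_two, hb0, hb1] at hv
    constructor
    · intro h1
      rw [h1, zero_smul, add_zero] at hv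
      rcases zmod2_eq_zero_or_one' ((b k).equivFun v 0) with h0 | h0
      · left; rw [← hv, h0, zero_smul]
      · right; rw [← hv, h0, one_smul]
    · rintro (rfl | rfl)
      · simp
      · have := (b k).equivFun_self 0 1
        rw [hb0] at this
        simpa using this
  have e0 : (Y.filter fun v => (b k).equivFun (v k) 0 = 0) = Y.filter fun v => v k = 0 ∨ v k = y k := by
    ext v; simp only [mem_filter, key0 (v k)]
  have e1 : (Y.filter fun v => (b k).equivFun (v k) 1 = 0) = Y.filter fun v => v k = 0 ∨ v k = x k := by
    ext v; simp only [mem_filter, key1 (v k)]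
  rw [e0, e1]
  exact hcond k

/-- The same theorem in the vocabulary of the `layer` line (`ClusLayer.UCIneq`, p511857): the two certificate codimensions are the
same `sInf`. -/
theorem ucIneq_two_of_nonCore (n : ℕ) (Y : Finset (Fin n → Fin 2 → ZMod 2))
    (x y : Fin n → (Fin 2 → ZMod 2)) (hx : ∀ k, x k ≠ 0) (hy : ∀ k, y k ≠ 0)
    (hxy : ∀ k, x k ≠ y k)
    (hcond : ∀ k : Fin n,
      2 * ((Y.filter fun v => v k = 0 ∨ v k = y k).card : ℤ) +
        2 * ((Y.filter fun v => v k = 0 ∨ v k = x k).card : ℤ) ≤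
          (Y.card : ℤ) + 4 * ((Y.filter fun v => v k = 0).card : ℤ)) :
    Summit.PneNP.PneNP.Theorems.ClusLayer.UCIneq n 2 Y := by
  unfold Summit.PneNP.PneNP.Theorems.ClusLayer.UCIneq
  exact universalCert_two_of_nonCore n Y x y hx hy hxy hcond

end

end Summit.PneNP.PneNP.Theorems.ClusCube
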